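import Mathlib
import HarnessLib
import Summits.ResolutionOfSingularities.ResolutionOfSingularities.Theorems.WildQuotientsWildQuotientResolutionS1aCuspMemberOXi
import Summits.ResolutionOfSingularities.ResolutionOfSingularities.Theorems.WildQuotientsWildQuotientResolutionS1aQhTailSection
import Summits.ResolutionOfSingularities.ResolutionOfSingularities.Theorems.WildQuotientsWildQuotientResolutionS1aCuspResidualO

/-!
# S1a — R4c cusp COVER brick at `O`, CHART-RING FORM: a prime of the producer chart ring `R_c` of `[N(x₁)]` over `W_O` containing the
# residual sections (`u₀′`, `t̂`) misses the member-defining norms `N_R(u₂′)`, `N_R(ĥ)` — hence misses the chart value `b̂` of `b_O`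

[OURS · L1 W4.5c · leafhand-res-wildquotients-7 g1] — NOT statements of the manuscript; counted 0; AI-level work, weaker than expert review. Crux
stmt-ResolutionOfSingularities-17941 `CyclicQuotientFourfolds`, line `s1a-logminvertex` v13 (`stub_reachLowerInFX`), R4c `cusp_killsIn_two` (crux-dir skeleton v2,
`Lines/s1a_logminvertex-R4c-PROGRESS-v2.md`, COVER obligation 1 at `O`: "residual points `R₀₁ ⊆ U_O = D(b_O)`"), hand-7 g0 repair census item (a)/(C1) at `O`.

✓`Cusp.cuspO_residual_not_mem_normX₁Chart` (hand 7 g0, p819581) is the certificate in the FREE polynomial model `k[s, x₀′, x₁′, x₂′, x₃]`. This file transports it to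
the actual producer CHART RING `R_c = ChartRing 𝒜 f (9,2,3) dbar y hy` of ✓`exists_cuspO_memberChart_rel_xi` through the pinned model isomorphism
`Φ : R_c ≃ k[s, x′][1/q]` (✓`FreeModel.exists_chartFreeModelEquiv`; `q ≠ 0`, `subst hh ∣ q`, `N(x₁′) ∣ q` as units of the model): primes `Q ⊂ R_c` are pulled back to
primes of `k[s, x′]` along `k[s,x′] → k[s,x′][1/q] ≃ R_c`; the residual generators go to `x₀′` (✓`hΦu`) and `x₂′² − x₁′³` (✓`QhAway.qhc_tail_eq` + ✓`QhSym.subst_cuspTail`),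
the norms to `N(x₂′)`, `N(h_O)` (✓`QhSym.qsc_map_normR_u2` / ✓`qsc_map_normR_hHat`).
* ★ `cuspO_norms_not_mem_of_residual` — `u₀′/1, t̂/1 ∈ Q` ⇒ `N_R(u₂′)/1, N_R(ĥ)/1, u₂′/1, u₁′/1, ĥ/1 ∉ Q`;
* ★ `cuspO_bHat_not_mem_of_residualSections` — the same from the residual SECTIONS `u₀′^{n₀}/c`, `t̂ⁿ/c ∈ Q` (✓`QhAbs.mem_of_residualSections_mem`), concluding
  `(N_R(u₂′)·N_R(ĥ))^{d′}/1 · (1/c)^{e} ∉ Q` — literally the chart value `E b_O` of the member open `U_O = D(b_O)` (`d′ = dbar`, `e = 3p + 3p`).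
What remains for (C1) at `O` is pure scheme glue: a point `v ∈ O′₀₁` off `D(z₀) ∪ D(z₁)` gives a prime of `Γ(O′₀₁) ≅ (R_c)₀` containing the residual sections, which
lies under a prime `Q` of `R_c` (degree-0 lying over), so `E b_O ∉ Q`, i.e. `v ∈ D(b_O)`.
-/

set_option linter.dupNamespace false

noncomputable section

open MvPolynomial
open Literature.AlgebraicGeometry.Resolution
open scoped LaurentPolynomial
open Summit.ResolutionOfSingularities.ResolutionOfSingularities.Theorems.WildQuotientResolution.S1
open Summit.ResolutionOfSingularities.ResolutionOfSingularities.Theorems.WildQuotientResolution.S1.CoarseChart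
open Summit.ResolutionOfSingularities.ResolutionOfSingularities.Theorems.WildQuotientResolution.S1.ProducerStep
open Summit.ResolutionOfSingularities.ResolutionOfSingularities.Theorems.WildQuotientResolution.S1.ReesBigrading
open Summit.ResolutionOfSingularities.ResolutionOfSingularities.Theorems.WildQuotientResolution.S1.NodeTransport
open Summit.ResolutionOfSingularities.ResolutionOfSingularities.Theorems.WildQuotientResolution.S1.CobordantTransport
open Summit.ResolutionOfSingularities.ResolutionOfSingularities.Theorems.WildQuotientResolution.S1.NodeAway
open Summit.ResolutionOfSingularities.ResolutionOfSingularities.Theorems.WildQuotientResolution.S1.CentreAway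
open Summit.ResolutionOfSingularities.ResolutionOfSingularities.Theorems.WildQuotientResolution.S1.BlowupCharts
open Summit.ResolutionOfSingularities.ResolutionOfSingularities.Theorems.WildQuotientResolution.S1.KillCert
open Summit.ResolutionOfSingularities.ResolutionOfSingularities.Theorems.WildQuotientResolution.S1.GameFrame.GModel

namespace Summit.ResolutionOfSingularities.ResolutionOfSingularities.Theorems.WildQuotientResolution.S1.KillCert.QhSym

variable {k : Type} [Field k] (σ : (MvPolynomial (Fin 4) k) ≃+* (MvPolynomial (Fin 4) k)) (hC : ∀ a : k, σ (C a) = C a)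
  (h0 : σ (X 0) = X 0) (h1 : σ (X 1) = X 1 + X 0) (h2 : σ (X 2) = X 2 + X 0) (h3 : σ (X 3) = X 3 + (X 2 ^ 2 - X 1 ^ 3))
  (hh : (MvPolynomial (Fin 4) k)) (hσh : σ hh = hh)
  {p : ℕ} (hp : 0 < p) (hσpL : ∀ y : (Localization.Away hh), (⇑(sigmaAway σ hσh))^[p] y = y)
  (hσJ : ∀ n : ℕ, ((weightedFiltration (fun i => algebraMap (MvPolynomial (Fin 4) k) (Localization.Away hh) (X ((![0, 1, 2] : Fin 3 → Fin 4) i))) (![9, 2, 3] : Fin 3 → ℕ)).ideal n).map ((sigmaAway σ hσh) : (Localization.Away hh) →+* (Localization.Away hh)) ≤ (weightedFiltration (fun i => algebraMap (MvPolynomial (Fin 4) k) (Localization.Away hh) (X ((![0, 1, 2] : Fin 3 → Fin 4) i))) (![9, 2, 3] : Fin 3 → ℕ)).ideal n)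
  (ht : algebraMap (MvPolynomial (Fin 4) k) (Localization.Away hh) (X 2 ^ 2 - X 1 ^ 3) ∈ (weightedFiltration (fun i => algebraMap (MvPolynomial (Fin 4) k) (Localization.Away hh) (X ((![0, 1, 2] : Fin 3 → Fin 4) i))) (![9, 2, 3] : Fin 3 → ℕ)).ideal 6)
  {mg : ℕ} (mo : Fin mg → ℕ) (𝒜 : (Π j : Fin mg, ZMod (mo j)) → AddSubgroup (Localization.Away hh)) [GradedRing 𝒜]
  {dbar : ℕ} (y : ↥(𝒜 0)) (hy : y ∈ (traceFiltration 𝒜 (fun i => algebraMap (MvPolynomial (Fin 4) k) (Localization.Away hh) (X ((![0, 1, 2] : Fin 3 → Fin 4) i))) (![9, 2, 3] : Fin 3 → ℕ)).ideal dbar) (hσy : (sigmaAway σ hσh) (y : (Localization.Away hh)) = y)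
  {qd : MvPolynomial (Option (Fin 4)) k} (hq0 : qd ≠ 0)
  (Φ : (ChartRing 𝒜 (fun i => algebraMap (MvPolynomial (Fin 4) k) (Localization.Away hh) (X ((![0, 1, 2] : Fin 3 → Fin 4) i))) (![9, 2, 3] : Fin 3 → ℕ) dbar y hy) ≃+* Localization.Away qd)
  (hΦa : ∀ a : (MvPolynomial (Fin 4) k), Φ ((algebraMap ↥(cobordantAlgebra (fun i => algebraMap (MvPolynomial (Fin 4) k) (Localization.Away hh) (X ((![0, 1, 2] : Fin 3 → Fin 4) i))) (![9, 2, 3] : Fin 3 → ℕ)) (ChartRing 𝒜 (fun i => algebraMap (MvPolynomial (Fin 4) k) (Localization.Away hh) (X ((![0, 1, 2] : Fin 3 → Fin 4) i))) (![9, 2, 3] : Fin 3 → ℕ) dbar y hy)) (algebraMap (Localization.Away hh) ↥(cobordantAlgebra (fun i => algebraMap (MvPolynomial (Fin 4) k) (Localization.Away hh) (X ((![0, 1, 2] : Fin 3 → Fin 4) i))) (![9, 2, 3] : Fin 3 → ℕ)) (algebraMap (MvPolynomial (Fin 4) k) (Localization.Away hh) a))) = (algebraMap (MvPolynomial (Option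 (Fin 4)) k) (Localization.Away qd)) (cobordantAlgebra.subst k (![9, 2, 3, 0] : Fin 4 → ℕ) a))
  (hΦs : Φ ((algebraMap ↥(cobordantAlgebra (fun i => algebraMap (MvPolynomial (Fin 4) k) (Localization.Away hh) (X ((![0, 1, 2] : Fin 3 → Fin 4) i))) (![9, 2, 3] : Fin 3 → ℕ)) (ChartRing 𝒜 (fun i => algebraMap (MvPolynomial (Fin 4) k) (Localization.Away hh) (X ((![0, 1, 2] : Fin 3 → Fin 4) i))) (![9, 2, 3] : Fin 3 → ℕ) dbar y hy)) (cobordantAlgebra.s (fun i => algebraMap (MvPolynomial (Fin 4) k) (Localization.Away hh) (X ((![0, 1, 2] : Fin 3 → Fin 4) i))) (![9, 2, 3] : Fin 3 → ℕ))) = (algebraMap (MvPolynomial (Option (Fin 4)) k) (Localization.Away qd)) (X none))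
  (hΦu : ∀ i : Fin 3, Φ ((algebraMap ↥(cobordantAlgebra (fun i => algebraMap (MvPolynomial (Fin 4) k) (Localization.Away hh) (X ((![0, 1, 2] : Fin 3 → Fin 4) i))) (![9, 2, 3] : Fin 3 → ℕ)) (ChartRing 𝒜 (fun i => algebraMap (MvPolynomial (Fin 4) k) (Localization.Away hh) (X ((![0, 1, 2] : Fin 3 → Fin 4) i))) (![9, 2, 3] : Fin 3 → ℕ) dbar y hy)) (cobordantAlgebra.u' (fun i => algebraMap (MvPolynomial (Fin 4) k) (Localization.Away hh) (X ((![0, 1, 2] : Fin 3 → Fin 4) i))) (![9, 2, 3] : Fin 3 → ℕ) i)) = (algebraMap (MvPolynomial (Option (Fin 4)) k) (Localization.Away qd)) (X (some ((![0, 1, 2] : Fin 3 → Fin 4) i))))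

set_option maxHeartbeats 1600000 in
set_option synthInstance.maxHeartbeats 400000 in
include hC h0 h1 h2 h3 hΦa hΦs hΦu hσy hq0 in
/-- ★ **Residual primes of the producer chart ring `[N(x₁)]` at `O` miss the member norms.** Let `Q` be a prime of the chart ring `R_c` containing
`u₀′/1` and the tail `t̂/1` (`t̂ = (x₂² − x₁³)·T⁶`). Then `N_R(u₂′)/1`, `N_R(ĥ)/1` (`ĥ = 2u₂′ − 3s·u₁′²`), `u₂′/1`, `u₁′/1`, `ĥ/1 ∉ Q`. Transport of
✓`Cusp.cuspO_residual_not_mem_normX₁Chart` through the pinned model `Φ`. [OURS · L1 W4.5c · R4c (C1) at `O`] -/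
theorem cuspO_norms_not_mem_of_residual [NeZero p] (hk3 : (3 : k) ≠ 0) (a : k) (ha9 : a * 9 = 4)
    (hhh : hh = ∏ l : ZMod p, (X 1 + C (-a) + (l.val : (MvPolynomial (Fin 4) k)) * X 0))
    -- the model inverts `subst hh` and the chart norm `N(x₁′)` (both divide the pinned `q`)
    (hUh : IsUnit ((algebraMap (MvPolynomial (Option (Fin 4)) k) (Localization.Away qd)) (cobordantAlgebra.subst k (![9, 2, 3, 0] : Fin 4 → ℕ) hh)))
    (hUN : IsUnit ((algebraMap (MvPolynomial (Option (Fin 4)) k) (Localization.Away qd)) (∏ l : ZMod p, (X (some 1) + (l.val : MvPolynomial (Option (Fin 4)) k) * (X none ^ 6 * (X (some 0) * X none ^ 1))))))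
    (Q : Ideal (ChartRing 𝒜 (fun i => algebraMap (MvPolynomial (Fin 4) k) (Localization.Away hh) (X ((![0, 1, 2] : Fin 3 → Fin 4) i))) (![9, 2, 3] : Fin 3 → ℕ) dbar y hy)) [hQ : Q.IsPrime]
    (hu0 : (algebraMap ↥(cobordantAlgebra (fun i => algebraMap (MvPolynomial (Fin 4) k) (Localization.Away hh) (X ((![0, 1, 2] : Fin 3 → Fin 4) i))) (![9, 2, 3] : Fin 3 → ℕ)) (ChartRing 𝒜 (fun i => algebraMap (MvPolynomial (Fin 4) k) (Localization.Away hh) (X ((![0, 1, 2] : Fin 3 → Fin 4) i))) (![9, 2, 3] : Fin 3 → ℕ) dbar y hy)) (cobordantAlgebra.u' (fun i => algebraMap (MvPolynomial (Fin 4) k) (Localization.Away hh) (X ((![0, 1, 2] : Fin 3 → Fin 4) i))) (![9, 2, 3] : Fin 3 → ℕ) 0) ∈ Q)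
    (htt : (algebraMap ↥(cobordantAlgebra (fun i => algebraMap (MvPolynomial (Fin 4) k) (Localization.Away hh) (X ((![0, 1, 2] : Fin 3 → Fin 4) i))) (![9, 2, 3] : Fin 3 → ℕ)) (ChartRing 𝒜 (fun i => algebraMap (MvPolynomial (Fin 4) k) (Localization.Away hh) (X ((![0, 1, 2] : Fin 3 → Fin 4) i))) (![9, 2, 3] : Fin 3 → ℕ) dbar y hy)) ⟨_, C_mul_T_mem_cobordantAlgebra _ _ ht⟩ ∈ Q) :
    (algebraMap ↥(cobordantAlgebra (fun i => algebraMap (MvPolynomial (Fin 4) k) (Localization.Away hh) (X ((![0, 1, 2] : Fin 3 → Fin 4) i))) (![9, 2, 3] : Fin 3 → ℕ)) (ChartRing 𝒜 (fun i => algebraMap (MvPolynomial (Fin 4) k) (Localization.Away hh) (X ((![0, 1, 2] : Fin 3 → Fin 4) i))) (![9, 2, 3] : Fin 3 → ℕ) dbar y hy)) (∏ j : ZMod p, (⇑(sigmaR (sigmaAway σ hσh) (fun i => algebraMap (MvPolynomial (Fin 4) k) (Localization.Away hh) (X ((![0, 1, 2] : Fin 3 → Fin 4) i))) (![9, 2,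 3] : Fin 3 → ℕ) hσJ hp hσpL))^[j.val] (cobordantAlgebra.u' (fun i => algebraMap (MvPolynomial (Fin 4) k) (Localization.Away hh) (X ((![0, 1, 2] : Fin 3 → Fin 4) i))) (![9, 2, 3] : Fin 3 → ℕ) 2)) ∉ Q ∧
    (algebraMap ↥(cobordantAlgebra (fun i => algebraMap (MvPolynomial (Fin 4) k) (Localization.Away hh) (X ((![0, 1, 2] : Fin 3 → Fin 4) i))) (![9, 2, 3] : Fin 3 → ℕ)) (ChartRing 𝒜 (fun i => algebraMap (MvPolynomial (Fin 4) k) (Localization.Away hh) (X ((![0, 1, 2] : Fin 3 → Fin 4) i))) (![9, 2, 3] : Fin 3 → ℕ) dbar y hy)) (∏ j : ZMod p, (⇑(sigmaR (sigmaAway σ hσh) (fun i => algebraMap (MvPolynomial (Fin 4) k) (Localization.Away hh) (X ((![0, 1, 2] : Fin 3 → Fin 4) i))) (![9, 2, 3] : Fin 3 → ℕ) hσJ hp hσpL))^[j.val] (2 * (cobordantAlgebra.u' (fun i => algebraMap (MvPolynomial (Fin 4) k) (Localization.Away hh) (X ((![0, 1, 2] : Fin 3 → Fin 4) i))) (![9,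 2, 3] : Fin 3 → ℕ) 2) - 3 * (cobordantAlgebra.s (fun i => algebraMap (MvPolynomial (Fin 4) k) (Localization.Away hh) (X ((![0, 1, 2] : Fin 3 → Fin 4) i))) (![9, 2, 3] : Fin 3 → ℕ)) * (cobordantAlgebra.u' (fun i => algebraMap (MvPolynomial (Fin 4) k) (Localization.Away hh) (X ((![0, 1, 2] : Fin 3 → Fin 4) i))) (![9, 2, 3] : Fin 3 → ℕ) 1) ^ 2)) ∉ Q ∧
    (algebraMap ↥(cobordantAlgebra (fun i => algebraMap (MvPolynomial (Fin 4) k) (Localization.Away hh) (X ((![0, 1, 2] : Fin 3 → Fin 4) i))) (![9, 2, 3] : Fin 3 → ℕ)) (ChartRing 𝒜 (fun i => algebraMap (MvPolynomial (Fin 4) k) (Localization.Away hh) (X ((![0, 1, 2] : Fin 3 → Fin 4) i))) (![9, 2, 3] : Fin 3 → ℕ) dbar y hy)) (cobordantAlgebra.u' (fun i => algebraMap (MvPolynomial (Fin 4) k) (Localization.Away hh) (X ((![0, 1, 2] : Fin 3 → Fin 4) i))) (![9, 2, 3] : Fin 3 → ℕ) 2) ∉ Q ∧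
    (algebraMap ↥(cobordantAlgebra (fun i => algebraMap (MvPolynomial (Fin 4) k) (Localization.Away hh) (X ((![0, 1, 2] : Fin 3 → Fin 4) i))) (![9, 2, 3] : Fin 3 → ℕ)) (ChartRing 𝒜 (fun i => algebraMap (MvPolynomial (Fin 4) k) (Localization.Away hh) (X ((![0, 1, 2] : Fin 3 → Fin 4) i))) (![9, 2, 3] : Fin 3 → ℕ) dbar y hy)) (cobordantAlgebra.u' (fun i => algebraMap (MvPolynomial (Fin 4) k) (Localization.Away hh) (X ((![0, 1, 2] : Fin 3 → Fin 4) i))) (![9, 2, 3] : Fin 3 → ℕ) 1) ∉ Q ∧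
    (algebraMap ↥(cobordantAlgebra (fun i => algebraMap (MvPolynomial (Fin 4) k) (Localization.Away hh) (X ((![0, 1, 2] : Fin 3 → Fin 4) i))) (![9, 2, 3] : Fin 3 → ℕ)) (ChartRing 𝒜 (fun i => algebraMap (MvPolynomial (Fin 4) k) (Localization.Away hh) (X ((![0, 1, 2] : Fin 3 → Fin 4) i))) (![9, 2, 3] : Fin 3 → ℕ) dbar y hy)) (2 * (cobordantAlgebra.u' (fun i => algebraMap (MvPolynomial (Fin 4) k) (Localization.Away hh) (X ((![0, 1, 2] : Fin 3 → Fin 4) i))) (![9, 2, 3] : Fin 3 → ℕ) 2) - 3 * (cobordantAlgebra.s (fun i => algebraMap (MvPolynomial (Fin 4) k) (Localization.Away hh) (X ((![0, 1, 2] : Fin 3 → Fin 4) i))) (![9, 2, 3] : Fin 3 → ℕ)) * (cobordantAlgebra.u' (fun i => algebraMap (MvPolynomial (Fin 4) k) (Localization.Away hh) (X ((![0, 1, 2] : Fin 3 → Fin 4) i))) (![9, 2, 3] : Fin 3 → ℕ) 1) ^ 2) ∉ Q := by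
  have hw1 : (![9, 2, 3] : Fin 3 → ℕ) 1 + 6 ≤ (![9, 2, 3] : Fin 3 → ℕ) 0 := by decide
  have hw2 : (![9, 2, 3] : Fin 3 → ℕ) 0 = (![9, 2, 3] : Fin 3 → ℕ) 2 + 6 := by decide
  have he1 : (![9, 2, 3] : Fin 3 → ℕ) 0 - ((![9, 2, 3] : Fin 3 → ℕ) 1 + 6) = 1 := by decide
  -- ### the transported primes: `Q' ⊂ k[s,x′][1/q]` (through `Φ`), `Q'' ⊂ k[s,x′]` (its contraction)
  let Q' : Ideal (Localization.Away qd) := Q.comap Φ.symm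
  haveI hQ' : Q'.IsPrime := Ideal.IsPrime.comap Φ.symm
  let Q'' : Ideal (MvPolynomial (Option (Fin 4)) k) := Q'.comap (algebraMap (MvPolynomial (Option (Fin 4)) k) (Localization.Away qd))
  haveI hQ'' : Q''.IsPrime := Ideal.IsPrime.comap _
  have hiff : ∀ x : (ChartRing 𝒜 (fun i => algebraMap (MvPolynomial (Fin 4) k) (Localization.Away hh) (X ((![0, 1, 2] : Fin 3 → Fin 4) i))) (![9, 2, 3] : Fin 3 → ℕ) dbar y hy), x ∈ Q ↔ Φ x ∈ Q' := fun x => by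
    change x ∈ Q ↔ Φ x ∈ Q.comap Φ.symm
    rw [Ideal.mem_comap, RingEquiv.symm_apply_apply]
  have hiffM : ∀ m : MvPolynomial (Option (Fin 4)) k, m ∈ Q'' ↔ (algebraMap (MvPolynomial (Option (Fin 4)) k) (Localization.Away qd)) m ∈ Q' := fun m => Ideal.mem_comap
  have hnu : ∀ m : MvPolynomial (Option (Fin 4)) k, IsUnit ((algebraMap (MvPolynomial (Option (Fin 4)) k) (Localization.Away qd)) m) → m ∉ Q'' := fun m hm hmQ =>
    hQ'.ne_top (Q'.eq_top_of_isUnit_mem ((hiffM m).mp hmQ) hm)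
  -- ### the residual generators in the model: `x₀′`, `x₂′² − x₁′³`
  have hX₀ : (X (some 0) : MvPolynomial (Option (Fin 4)) k) ∈ Q'' := by
    have hu := hΦu 0
    change _ = (algebraMap (MvPolynomial (Option (Fin 4)) k) (Localization.Away qd)) (X (some 0)) at hu
    rw [hiffM, ← hu]
    exact (hiff _).mp hu0
  have hφ : (X (some 2) ^ 2 - X (some 1) ^ 3 : MvPolynomial (Option (Fin 4)) k) ∈ Q'' := by
    rw [hiffM, ← KillCert.QhAway.qhc_tail_eq (X 2 ^ 2 - X 1 ^ 3) (![9, 2, 3] : Fin 3 → ℕ) 6 hh mo 𝒜 y hy hq0 Φ hΦa hΦs ht (X (some 2) ^ 2 - X (some 1) ^ 3 : MvPolynomial (Option (Fin 4)) k) (KillCert.QhSym.subst_cuspTail (k := k))]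
    exact (hiff _).mp htt
  -- ### the units of the model: `N(x₁′)`, `subst hh`
  have hN₁ : (∏ l : ZMod p, (X (some 1) + (l.val : MvPolynomial (Option (Fin 4)) k) * (X none ^ 6 * (X (some 0) * X none ^ 1)))) ∉ Q'' := hnu _ hUN
  have hsubX : ∀ i : Fin 4, cobordantAlgebra.subst k (![9, 2, 3, 0] : Fin 4 → ℕ) (X i) = X none ^ (![9, 2, 3, 0] : Fin 4 → ℕ) i * X (some i) := fun i => by
    rw [cobordantAlgebra.subst, MvPolynomial.eval₂Hom_X']
  have hsubC : ∀ a' : k, cobordantAlgebra.subst k (![9, 2, 3, 0] : Fin 4 → ℕ) (C a') = C a' := fun a' => by rw [cobordantAlgebra.subst, MvPolynomial.eval₂Hom_C]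
  have hsubst_hh : cobordantAlgebra.subst k (![9, 2, 3, 0] : Fin 4 → ℕ) hh = ∏ l : ZMod p, (X none ^ 2 * X (some 1) + C (-a) + (l.val : (MvPolynomial (Option (Fin 4)) k)) * (X none ^ 9 * X (some 0))) := by
    rw [hhh, map_prod]
    refine Finset.prod_congr rfl fun l _ => ?_
    rw [map_add, map_add, map_mul, map_natCast, hsubX, hsubX, hsubC]
    rfl
  have hhh' : (∏ l : ZMod p, (X none ^ 2 * X (some 1) + C (-a) + (l.val : MvPolynomial (Option (Fin 4)) k) * (X none ^ 9 * X (some 0)))) ∉ Q'' := by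
    rw [← hsubst_hh]; exact hnu _ hUh
  -- ### the free-model certificate
  obtain ⟨hX₂, hX₁, hO, hN₂, hNH⟩ := Cusp.cuspO_residual_not_mem_normX₁Chart (p := p) hk3 a ha9 Q'' hX₀ hφ hN₁ hhh'
  -- ### transport back to `R_c`
  have hu2 := hΦu 2
  change _ = (algebraMap (MvPolynomial (Option (Fin 4)) k) (Localization.Away qd)) (X (some 2)) at hu2
  have hu1 := hΦu 1
  change _ = (algebraMap (MvPolynomial (Option (Fin 4)) k) (Localization.Away qd)) (X (some 1)) at hu1
  refine ⟨fun h => hN₂ ?_, fun h => hNH ?_, fun h => hX₂ ?_, fun h => hX₁ ?_, fun h => hO ?_⟩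
  · rw [hiffM, ← qsc_map_normR_u2 σ hC h0 h1 h2 (X 2 ^ 2 - X 1 ^ 3) h3 (![9, 2, 3] : Fin 3 → ℕ) 6 hw2 hh hσh hp hσpL hσJ mo 𝒜 y hy hσy Φ hΦa hΦs hΦu]
    exact (hiff _).mp h
  · have h' := (hiff _).mp h
    rw [qsc_map_normR_hHat σ hC h0 h1 h2 (X 2 ^ 2 - X 1 ^ 3) h3 (![9, 2, 3] : Fin 3 → ℕ) 6 hw1 hw2 hh hσh hp hσpL hσJ mo 𝒜 y hy hσy Φ hΦa hΦs hΦu, he1] at h'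
    exact (hiffM _).mpr h'
  · rw [hiffM, ← hu2]; exact (hiff _).mp h
  · rw [hiffM, ← hu1]; exact (hiff _).mp h
  · have h' := (hiff _).mp h
    have heq : Φ ((algebraMap ↥(cobordantAlgebra (fun i => algebraMap (MvPolynomial (Fin 4) k) (Localization.Away hh) (X ((![0, 1, 2] : Fin 3 → Fin 4) i))) (![9, 2, 3] : Fin 3 → ℕ)) (ChartRing 𝒜 (fun i => algebraMap (MvPolynomial (Fin 4) k) (Localization.Away hh) (X ((![0, 1, 2] : Fin 3 → Fin 4) i))) (![9, 2, 3] : Fin 3 → ℕ) dbar y hy)) (2 * (cobordantAlgebra.u' (fun i => algebraMap (MvPolynomial (Fin 4) k) (Localization.Away hh) (X ((![0, 1, 2] : Fin 3 → Fin 4) i))) (![9, 2, 3] : Fin 3 → ℕ) 2) - 3 * (cobordantAlgebra.s (fun i => algebraMap (MvPolynomial (Fin 4) k) (Localization.Away hh) (X ((![0, 1, 2] : Fin 3 → Fin 4) i))) (![9, 2, 3] : Fin 3 → ℕ)) * (cobordantAlgebra.u' (fun i => algebraMap (MvPolynomial (Fin 4) k) (Localization.Away hh) (X ((![0, 1, 2]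 : Fin 3 → Fin 4) i))) (![9, 2, 3] : Fin 3 → ℕ) 1) ^ 2)) =
        (algebraMap (MvPolynomial (Option (Fin 4)) k) (Localization.Away qd)) (2 * X (some 2) - 3 * X none * X (some 1) ^ 2) := by
      simp only [map_sub, map_mul, map_pow, map_ofNat, hu2, hu1, hΦs]
    rw [heq] at h'
    exact (hiffM _).mpr h'

set_option maxHeartbeats 1600000 in
set_option synthInstance.maxHeartbeats 400000 in
include hC h0 h1 h2 h3 hΦa hΦs hΦu hσy hq0 in
/-- ★ **The chart value of `b_O` is not in a residual prime.** On the producer chart ring `R_c` of `[N(x₁)]` at `O`, a prime `Q` containing the two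
RESIDUAL SECTIONS `u₀′^{n₀}/c` and `t̂ⁿ/c` (`n₀, n > 0`; ✓`QhAbs.qha_residualSection_zero` / ✓`qha_residualSection_tail`) does not contain
`((N_R(u₂′)·N_R(ĥ))^{d′})/1 · (1/c)^{e}` — for `d′ = dbar`, `e = 3p + 3p` literally the chart value `E b_O` of the member open `U_O = D(b_O)` of
✓`exists_cuspO_memberChart_rel_xi`. So the residual points of `O′₀₁` lie in `U_O` once points are read as primes of `R_c`. [OURS · L1 W4.5c · R4c (C1) at `O`] -/
theorem cuspO_bHat_not_mem_of_residualSections [NeZero p] (hk3 : (3 : k) ≠ 0) (a : k) (ha9 : a * 9 = 4)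
    (hhh : hh = ∏ l : ZMod p, (X 1 + C (-a) + (l.val : (MvPolynomial (Fin 4) k)) * X 0))
    -- the model inverts `subst hh` and the chart norm `N(x₁′)` (both divide the pinned `q`)
    (hUh : IsUnit ((algebraMap (MvPolynomial (Option (Fin 4)) k) (Localization.Away qd)) (cobordantAlgebra.subst k (![9, 2, 3, 0] : Fin 4 → ℕ) hh)))
    (hUN : IsUnit ((algebraMap (MvPolynomial (Option (Fin 4)) k) (Localization.Away qd)) (∏ l : ZMod p, (X (some 1) + (l.val : MvPolynomial (Option (Fin 4)) k) * (X none ^ 6 * (X (some 0) * X none ^ 1))))))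
    (Q : Ideal (ChartRing 𝒜 (fun i => algebraMap (MvPolynomial (Fin 4) k) (Localization.Away hh) (X ((![0, 1, 2] : Fin 3 → Fin 4) i))) (![9, 2, 3] : Fin 3 → ℕ) dbar y hy)) [hQ : Q.IsPrime]
    {n₀ n : ℕ} (hn₀ : 0 < n₀) (hn : 0 < n)
    (h0sec : (algebraMap ↥(cobordantAlgebra (fun i => algebraMap (MvPolynomial (Fin 4) k) (Localization.Away hh) (X ((![0, 1, 2] : Fin 3 → Fin 4) i))) (![9, 2, 3] : Fin 3 → ℕ)) (ChartRing 𝒜 (fun i => algebraMap (MvPolynomial (Fin 4) k) (Localization.Away hh) (X ((![0, 1, 2] : Fin 3 → Fin 4) i))) (![9, 2, 3] : Fin 3 → ℕ) dbar y hy)) (cobordantAlgebra.u' (fun i => algebraMap (MvPolynomial (Fin 4) k) (Localization.Away hh) (X ((![0, 1, 2] : Fin 3 → Fin 4) i))) (![9, 2, 3] : Fin 3 → ℕ) 0 ^ n₀) * IsLocalization.Away.invSelf (coverElement 𝒜 (fun i => algebraMap (MvPolynomial (Fin 4) k) (Localization.Away hh) (X ((![0, 1, 2] : Fin 3 → Fin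 4) i))) (![9, 2, 3] : Fin 3 → ℕ) dbar y hy) ∈ Q)
    (h1sec : (algebraMap ↥(cobordantAlgebra (fun i => algebraMap (MvPolynomial (Fin 4) k) (Localization.Away hh) (X ((![0, 1, 2] : Fin 3 → Fin 4) i))) (![9, 2, 3] : Fin 3 → ℕ)) (ChartRing 𝒜 (fun i => algebraMap (MvPolynomial (Fin 4) k) (Localization.Away hh) (X ((![0, 1, 2] : Fin 3 → Fin 4) i))) (![9, 2, 3] : Fin 3 → ℕ) dbar y hy)) (((⟨_, C_mul_T_mem_cobordantAlgebra _ _ ht⟩ : ↥(cobordantAlgebra (fun i => algebraMap (MvPolynomial (Fin 4) k) (Localization.Away hh) (X ((![0, 1, 2] : Fin 3 → Fin 4) i))) (![9, 2, 3] : Fin 3 → ℕ)))) ^ n) * IsLocalization.Away.invSelf (coverElement 𝒜 (fun i => algebraMap (MvPolynomial (Fin 4) k) (Localization.Away hh) (X ((![0, 1, 2] : Fin 3 → Fin 4) i))) (![9, 2, 3] : Fin 3 → ℕ) dbar y hy) ∈ Q)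
    (d' e : ℕ) :
    (algebraMap ↥(cobordantAlgebra (fun i => algebraMap (MvPolynomial (Fin 4) k) (Localization.Away hh) (X ((![0, 1, 2] : Fin 3 → Fin 4) i))) (![9, 2, 3] : Fin 3 → ℕ)) (ChartRing 𝒜 (fun i => algebraMap (MvPolynomial (Fin 4) k) (Localization.Away hh) (X ((![0, 1, 2] : Fin 3 → Fin 4) i))) (![9, 2, 3] : Fin 3 → ℕ) dbar y hy)) (((∏ j : ZMod p, (⇑(sigmaR (sigmaAway σ hσh) (fun i => algebraMap (MvPolynomial (Fin 4) k) (Localization.Away hh) (X ((![0, 1, 2] : Fin 3 → Fin 4) i))) (![9, 2, 3] : Fin 3 → ℕ) hσJ hp hσpL))^[j.val] (cobordantAlgebra.u' (fun i => algebraMap (MvPolynomial (Fin 4) k) (Localization.Away hh) (X ((![0, 1, 2] : Fin 3 → Fin 4) i))) (![9, 2, 3] : Fin 3 → ℕ) 2)) * ∏ j : ZMod p, (⇑(sigmaR (sigmaAway σ hσh) (fun i => algebraMap (MvPolynomial (Fin 4) k) (Localization.Away hh) (X ((![0, 1, 2] : Fin 3 → Fin 4) i))) (![9, 2, 3] : Fin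 3 → ℕ) hσJ hp hσpL))^[j.val] (2 * (cobordantAlgebra.u' (fun i => algebraMap (MvPolynomial (Fin 4) k) (Localization.Away hh) (X ((![0, 1, 2] : Fin 3 → Fin 4) i))) (![9, 2, 3] : Fin 3 → ℕ) 2) - 3 * (cobordantAlgebra.s (fun i => algebraMap (MvPolynomial (Fin 4) k) (Localization.Away hh) (X ((![0, 1, 2] : Fin 3 → Fin 4) i))) (![9, 2, 3] : Fin 3 → ℕ)) * (cobordantAlgebra.u' (fun i => algebraMap (MvPolynomial (Fin 4) k) (Localization.Away hh) (X ((![0, 1, 2] : Fin 3 → Fin 4) i))) (![9, 2, 3] : Fin 3 → ℕ) 1) ^ 2)) ^ d') *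
        IsLocalization.Away.invSelf (coverElement 𝒜 (fun i => algebraMap (MvPolynomial (Fin 4) k) (Localization.Away hh) (X ((![0, 1, 2] : Fin 3 → Fin 4) i))) (![9, 2, 3] : Fin 3 → ℕ) dbar y hy) ^ e ∉ Q := by
  obtain ⟨hu0, htt⟩ := QhAbs.mem_of_residualSections_mem (fun i => algebraMap (MvPolynomial (Fin 4) k) (Localization.Away hh) (X ((![0, 1, 2] : Fin 3 → Fin 4) i))) (algebraMap (MvPolynomial (Fin 4) k) (Localization.Away hh) (X 2 ^ 2 - X 1 ^ 3)) (![9, 2, 3] : Fin 3 → ℕ) 6 ht mo 𝒜 y hy n₀ n Q h0sec h1sec hn₀ hn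
  obtain ⟨hN₂, hNH, -, -, -⟩ := cuspO_norms_not_mem_of_residual σ hC h0 h1 h2 h3 hh hσh hp hσpL hσJ ht mo 𝒜 y hy hσy hq0 Φ hΦa hΦs hΦu hk3 a ha9 hhh hUh hUN Q hu0 htt
  have hunit : IsUnit (IsLocalization.Away.invSelf (S := ChartRing 𝒜 (fun i => algebraMap (MvPolynomial (Fin 4) k) (Localization.Away hh) (X ((![0, 1, 2] : Fin 3 → Fin 4) i))) (![9, 2, 3] : Fin 3 → ℕ) dbar y hy) (coverElement 𝒜 (fun i => algebraMap (MvPolynomial (Fin 4) k) (Localization.Away hh) (X ((![0, 1, 2] : Fin 3 → Fin 4) i))) (![9, 2, 3] : Fin 3 → ℕ) dbar y hy)) :=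
    IsUnit.of_mul_eq_one (algebraMap _ (ChartRing 𝒜 (fun i => algebraMap (MvPolynomial (Fin 4) k) (Localization.Away hh) (X ((![0, 1, 2] : Fin 3 → Fin 4) i))) (![9, 2, 3] : Fin 3 → ℕ) dbar y hy) (coverElement 𝒜 (fun i => algebraMap (MvPolynomial (Fin 4) k) (Localization.Away hh) (X ((![0, 1, 2] : Fin 3 → Fin 4) i))) (![9, 2, 3] : Fin 3 → ℕ) dbar y hy))
      (by rw [mul_comm]; exact IsLocalization.Away.mul_invSelf _)
  intro h
  rcases hQ.mem_or_mem h with h | h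
  · rw [map_pow] at h
    rcases hQ.mem_or_mem ((map_mul (algebraMap ↥(cobordantAlgebra (fun i => algebraMap (MvPolynomial (Fin 4) k) (Localization.Away hh) (X ((![0, 1, 2] : Fin 3 → Fin 4) i))) (![9, 2, 3] : Fin 3 → ℕ)) (ChartRing 𝒜 (fun i => algebraMap (MvPolynomial (Fin 4) k) (Localization.Away hh) (X ((![0, 1, 2] : Fin 3 → Fin 4) i))) (![9, 2, 3] : Fin 3 → ℕ) dbar y hy)) _ _) ▸ hQ.mem_of_pow_mem _ h) with h' | h'
    · exact hN₂ h'
    · exact hNH h'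
  · exact hQ.ne_top (Q.eq_top_of_isUnit_mem h (hunit.pow e))

end Summit.ResolutionOfSingularities.ResolutionOfSingularities.Theorems.WildQuotientResolution.S1.KillCert.QhSym

end
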